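import Literature.NumberTheory.Transcendental.ZudilinLinearForm
import Literature.NumberTheory.Transcendental.ZudilinPhiGrowth
import HarnessLib

/-!
# Zudilin's Theorem 3 reduced to the decay and non-vanishing of the linear forms `Sₙ`

Topic `Literature/NumberTheory/Transcendental`. Assembly of the arithmetic half of the proof of
[Zudilin2004, Theorem 3] ("one of `ζ(5), ζ(7), ζ(9), ζ(11)` is irrational",
`Literature.NumberTheory.Transcendental.zudilin`): with

* the linear forms `2 D_{35n}³ D_{34n} D_{33n}⁸ Sₙ = Φₙ (a₀ + a₁ζ(5) + a₂ζ(7) + a₃ζ(9) + a₄ζ(11))`,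
  `aᵢ ∈ ℤ` (`Zudilin2004.linearForms_arith`, [Zudilin2004, Lemma 19], `ZudilinLinearForm.lean`),
* the growth `D_{35n}³ D_{34n} D_{33n}⁸ ≤ e^{(403+ε)n}` (`Zudilin2004.eventually_D_le_exp_of_pos`)
  and `Φₙ ≥ e^{176.6 n}` (`Zudilin2004.Phi_growth`, [Zudilin2004, p. 270–271],
  `ZudilinPhiGrowth.lean`),
* the irrationality criterion (`Zudilin2004.zudilin_of_linearForms_of_lt`, `ZudilinOddZeta.lean`),

Theorem 3 follows from the remaining analytic input, [Zudilin2004, Lemma 20]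
(`limsup_n log|Sₙ|/n = −C₀`, `C₀ = 227.58019641…`), in the weak form: for SOME `c₁ > 226.4`,
`|Sₙ| ≤ e^{−c₁ n}` for all large `n` and `Sₙ ≠ 0` infinitely often —
`Zudilin2004.zudilin_of_decay`. Everything here is PROVED (no named facts).

## References

* [Zudilin2004] W. Zudilin, *Arithmetic of linear forms involving odd zeta values*, J. Théor.
  Nombres Bordeaux 16 (2004), 251–291, §8: Lemma 19, Lemma 20, Proposition 5, Theorem 3.
-/

noncomputable section

open Filter

namespace Literature.NumberTheory.Transcendental

namespace Zudilin2004

/-- **Zudilin's Theorem 3, given Lemma 20.** If `|Sₙ| ≤ e^{−c₁ n}` for all large `n` with some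
`c₁ > 226.4 = 403 − 176.6` and `Sₙ ≠ 0` for infinitely many `n` (both consequences of
[Zudilin2004, Lemma 20]: `limsup log|Sₙ|/n = −227.58019641…`), then one of
`ζ(5), ζ(7), ζ(9), ζ(11)` is irrational. [cite: Zudilin2004, §8 Lemma 19, Lemma 20, Prop. 5, Thm. 3] -/
theorem zudilin_of_decay {c₁ : ℝ} (hc : (1132 / 5 : ℝ) < c₁)
    (hdecay : ∀ᶠ n : ℕ in atTop, |S n| ≤ Real.exp (-c₁ * n))
    (hnonvanish : ∃ᶠ n : ℕ in atTop, S n ≠ 0) : zudilin :=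
  zudilin_of_linearForms_of_lt (c₁ := c₁) (c₂ := 883 / 5) (by linarith) linearForms_arith hdecay
    hnonvanish Phi_growth

end Zudilin2004

end Literature.NumberTheory.Transcendental
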